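import Literature.AlgebraicGeometry.Resolution.SeparatingTranscendenceBasis
import Mathlib.FieldTheory.Relrank
import Mathlib.RingTheory.AlgebraicIndependent.TranscendenceBasis
import HarnessLib

/-!
# A separating element for function fields of transcendence degree one over a perfect field

Topic: `Literature/AlgebraicGeometry/Resolution`. PROVED field theory used in the proof of
Kuhlmann 2010, Lemma 5.5, Case II (arXiv:1003.5678, p. 19): "Since `F̄|K̄(x̄)` is finite and
`K̄(x̄)` is a function field of transcendence degree `1` over `K̄`, the same holds for `F̄`. Since
`K̄` is algebraically closed [perfect suffices], there is a separating transcendence basis `{ξ}` of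
`F̄|K̄`" — combined with "`F̄ = K̄(ξ, η)` for some `η` which is separable-algebraic over `K̄(ξ)`".
Rendered inside an ambient field `Φ` for subfields `B ≤ L`:

* `exists_separating_element` — if `B` is perfect, `t ∈ L` is transcendental over `B` and `L`
  is finite over `B(t)`, then there is `ξ ∈ L`, transcendental over `B`, with `L` finite over
  `B(ξ)` and every element of `L` separable over `B(ξ)`. PROVED from Mathlib's
  `exists_isTranscendenceBasis_and_isSeparable_of_perfectField` (finitely generated extensions of
  perfect fields are separably generated) and the invariance of the cardinality of transcendence
  bases (`IsTranscendenceBasis.cardinalMk_eq`): a separating transcendence basis of `L|B` has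
  exactly one element.

## Sources

* F.-V. Kuhlmann, Trans. AMS 362 (2010) = arXiv:1003.5678, proof of Lemma 5.5 (p. 19).
  [folklore] (Lang, *Algebra*, VIII §4; Mathlib `Mathlib.FieldTheory.SeparablyGenerated`).
-/

noncomputable section

open IntermediateField

namespace Literature.AlgebraicGeometry.Resolution

universe u

variable {Φ : Type u} [Field Φ]

/-- Elements of an intermediate field `M` of `Φ|B` containing `B(t)` and finite over it lie in
`B(t, b₁, …, b_d)` for a `B(t)`-basis `b` of `M`. [folklore] -/
theorem exists_finset_adjoin_eq_of_finite {B : Subfield Φ} (M : IntermediateField B Φ)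
    (k₀ : IntermediateField B Φ) (hk : k₀ ≤ M)
    [FiniteDimensional k₀ (extendScalars hk)] :
    ∃ T : Finset Φ, (↑T : Set Φ) ⊆ M ∧ adjoin B ((k₀ : Set Φ) ∪ ↑T) = M := by
  classical
  set M' : IntermediateField k₀ Φ := extendScalars hk
  let b := Module.finBasis k₀ M'
  refine ⟨Finset.univ.image fun i => ((b i : M') : Φ), ?_, le_antisymm ?_ ?_⟩
  · intro z hz
    obtain ⟨i, -, rfl⟩ := Finset.mem_image.mp hz
    exact (b i).2
  · rw [adjoin_le_iff]
    rintro z (hz | hz)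
    · exact hk hz
    · obtain ⟨i, -, rfl⟩ := Finset.mem_image.mp (Finset.mem_coe.mp hz)
      exact (b i).2
  · intro z hz
    have hz' : (⟨z, hz⟩ : M') = ∑ i, b.repr ⟨z, hz⟩ i • b i := (b.sum_repr _).symm
    have h1 := congrArg (fun w : M' => (w : Φ)) hz'
    simp only [IntermediateField.coe_sum, IntermediateField.coe_smul] at h1
    have hmem : (∑ i, (b.repr ⟨z, hz⟩ i) • ((b i : M') : Φ)) ∈
        adjoin B ((k₀ : Set Φ) ∪ ↑(Finset.univ.image fun i => ((b i : M') : Φ))) := by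
      refine sum_mem fun i _ => ?_
      rw [Algebra.smul_def]
      refine mul_mem ?_ ?_
      · exact subset_adjoin B _ (Or.inl (b.repr ⟨z, hz⟩ i).2)
      · exact subset_adjoin B _ (Or.inr (Finset.mem_coe.mpr
          (Finset.mem_image.mpr ⟨i, Finset.mem_univ _, rfl⟩)))
    rwa [← h1] at hmem

/-- **A function field of transcendence degree one over a perfect field has a separating
element** ("there is a separating transcendence basis `{ξ}` of `F̄|K̄` … `F̄|K̄(ξ)` is a finite
separable extension", Kuhlmann 2010, proof of Lemma 5.5): for subfields `B ≤ L` of `Φ` with `B`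
perfect, `t ∈ L` transcendental over `B` and `L` finite over `B(t)`, there is `ξ ∈ L`
transcendental over `B` with `L` finite over `B(ξ)` and every element of `L` separable over
`B(ξ)`. PROVED (Mathlib's separably generated extensions of perfect fields; a transcendence
basis of `L|B` has one element). [folklore] -/
theorem exists_separating_element {B L : Subfield Φ} [PerfectField B] (hBL : B ≤ L) {t : Φ}
    (htL : t ∈ L) (ht : Transcendental B t)
    (hle : (adjoin B ({t} : Set Φ)).toSubfield ≤ L)
    (hfin : 0 < Subfield.relfinrank (adjoin B ({t} : Set Φ)).toSubfield L) :
    ∃ ξ ∈ L, Transcendental B ξ ∧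
      (adjoin B ({ξ} : Set Φ)).toSubfield ≤ L ∧
      0 < Subfield.relfinrank (adjoin B ({ξ} : Set Φ)).toSubfield L ∧
      ∀ z ∈ L, IsSeparable (adjoin B ({ξ} : Set Φ)) z := by
  classical
  set M : IntermediateField B Φ := Subfield.extendScalars hBL with hM
  have hmemM : ∀ z : Φ, z ∈ M ↔ z ∈ L := fun z => Iff.rfl
  set k₀ : IntermediateField B Φ := adjoin B ({t} : Set Φ) with hk₀
  have hk₀M : k₀ ≤ M := fun z hz => hle hz
  -- `M` is finite over `k₀ = B(t)`
  haveI hfinM : FiniteDimensional k₀ (extendScalars hk₀M) := by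
    have h1 : Subfield.relfinrank k₀.toSubfield L =
        Module.finrank k₀ (Subfield.extendScalars (F := k₀.toSubfield) (E := L) hle) :=
      Subfield.relfinrank_eq_finrank_of_le hle
    rw [h1] at hfin
    exact Module.finite_of_finrank_pos hfin
  haveI halgk₀ : Algebra.IsAlgebraic k₀ (extendScalars hk₀M) := Algebra.IsAlgebraic.of_finite k₀ _
  -- `M = B(t, T)` is finitely generated over `B`
  obtain ⟨T, hTM, hgen⟩ := exists_finset_adjoin_eq_of_finite M k₀ hk₀M
  have hgen' : adjoin B (↑(insert t T) : Set Φ) = M := by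
    rw [← hgen, hk₀]
    apply le_antisymm
    · rw [adjoin_le_iff, Finset.coe_insert]
      rintro z (rfl | hz)
      · exact subset_adjoin B _ (Or.inl (mem_adjoin_simple_self B z))
      · exact subset_adjoin B _ (Or.inr hz)
    · rw [adjoin_le_iff]
      rintro z (hz | hz)
      · exact adjoin.mono B _ _ (by simp) hz
      · exact subset_adjoin B _ (by simp [hz])
  haveI : Algebra.EssFiniteType B M := by
    rw [IntermediateField.essFiniteType_iff, ← hgen']
    exact fg_adjoin_finset _
  -- a separating transcendence basis `s₀` of `M|B`
  obtain ⟨s₀, hbasis, hsep⟩ := exists_isTranscendenceBasis_and_isSeparable_of_perfectField B M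
  -- `{t}` is a transcendence basis of `M|B`, so `s₀` has one element
  set t' : M := ⟨t, (hmemM t).mpr htL⟩ with ht'
  have ht'tr : Transcendental B t' :=
    (transcendental_algebraMap_iff (algebraMap M Φ).injective).mp ht
  -- `B(t') ⊆ M` (inside `M`) versus `k₀ = B(t) ⊆ Φ`
  have hliftk : ∀ w : Φ, w ∈ lift (adjoin B ({t'} : Set M)) ↔ w ∈ k₀ := fun w => by
    rw [lift_adjoin, Set.image_singleton]
  let f₀ : adjoin B ({t'} : Set M) →+* k₀ :=
    { toFun := fun w => ⟨((w : M) : Φ), (hliftk _).mp ((mem_lift (w : M)).mpr w.2)⟩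
      map_one' := rfl
      map_mul' := fun _ _ => rfl
      map_zero' := rfl
      map_add' := fun _ _ => rfl }
  have hf₀ : Function.Surjective f₀ := by
    rintro ⟨u, hu⟩
    have hu' : u ∈ lift (adjoin B ({t'} : Set M)) := (hliftk u).mpr hu
    exact ⟨⟨⟨u, lift_le _ hu'⟩, (mem_lift ⟨u, lift_le _ hu'⟩).mp hu'⟩, rfl⟩
  -- elements of `M` are algebraic over `B(t')`
  have halgM : Algebra.IsAlgebraic (adjoin B ({t'} : Set M)) M := by
    refine ⟨fun z => ?_⟩
    have hz₂ : IsAlgebraic k₀ (z : Φ) :=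
      (Algebra.IsAlgebraic.isAlgebraic (⟨(z : Φ), z.2⟩ : extendScalars hk₀M)).algebraMap
    exact hz₂.of_ringHom_of_comp_eq f₀ (algebraMap M Φ) hf₀ (algebraMap M Φ).injective
      (RingHom.ext fun _ => rfl)
  -- `{t'}` is a transcendence basis of `M|B`
  have hTB : IsTranscendenceBasis B ((↑) : ({t'} : Set M) → M) := by
    have hind : AlgebraicIndependent B ((↑) : ({t'} : Set M) → M) :=
      (algebraicIndependent_singleton_iff (⟨t', Set.mem_singleton t'⟩ : ({t'} : Set M))).mpr ht'tr
    refine hind.isTranscendenceBasis_iff_isAlgebraic.mpr ?_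
    rw [Subtype.range_coe]
    exact IntermediateField.isAlgebraic_adjoin_iff_top.mp halgM
  -- hence `s₀ = {ξ'}`
  have hcard : s₀.card = 1 := by
    have h := hbasis.cardinalMk_eq hTB
    rw [Cardinal.mk_coe_finset, Cardinal.mk_singleton] at h
    exact_mod_cast h
  obtain ⟨ξ', hs₀⟩ := Finset.card_eq_one.mp hcard
  subst hs₀
  have hξ'tr : Transcendental B ξ' := by
    haveI : Subsingleton (↥({ξ'} : Finset M)) :=
      ⟨fun a b => Subtype.ext ((Finset.mem_singleton.mp a.2).trans (Finset.mem_singleton.mp b.2).symm)⟩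
    exact (algebraicIndependent_singleton_iff
      (⟨ξ', Finset.mem_singleton_self ξ'⟩ : (↥({ξ'} : Finset M)))).mp hbasis.1
  -- the separating element `ξ ∈ L`
  set ξ : Φ := (ξ' : Φ) with hξ
  have hξL : ξ ∈ L := ξ'.2
  have hξtr : Transcendental B ξ :=
    (transcendental_algebraMap_iff (algebraMap M Φ).injective).mpr hξ'tr
  set kξ : IntermediateField B Φ := adjoin B ({ξ} : Set Φ) with hkξ
  have hkξM : kξ ≤ M := adjoin_le_iff.mpr (Set.singleton_subset_iff.mpr ξ'.2)
  have hkξL : kξ.toSubfield ≤ L := fun z hz => hkξM hz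
  -- `B(ξ') ⊆ M` versus `kξ = B(ξ) ⊆ Φ`
  have hliftξ : ∀ w : Φ, w ∈ lift (adjoin B ({ξ'} : Set M)) ↔ w ∈ kξ := fun w => by
    rw [lift_adjoin, Set.image_singleton]
  let f₁ : adjoin B ({ξ'} : Set M) →+* kξ :=
    { toFun := fun w => ⟨((w : M) : Φ), (hliftξ _).mp ((mem_lift (w : M)).mpr w.2)⟩
      map_one' := rfl
      map_mul' := fun _ _ => rfl
      map_zero' := rfl
      map_add' := fun _ _ => rfl }
  have hf₁c : (algebraMap kξ Φ).comp f₁ =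
      (algebraMap M Φ).comp (algebraMap (adjoin B ({ξ'} : Set M)) M) := RingHom.ext fun _ => rfl
  -- separability over `B(ξ)`
  have hcoe : ((↑({ξ'} : Finset M)) : Set M) = {ξ'} := Finset.coe_singleton ξ'
  have hsepΦ : ∀ z ∈ L, IsSeparable kξ z := by
    intro z hz
    have h1 : IsSeparable (adjoin B ((↑({ξ'} : Finset M)) : Set M)) (⟨z, hz⟩ : M) :=
      Algebra.IsSeparable.isSeparable _ _
    rw [hcoe] at h1
    have h2 : IsSeparable (adjoin B ({ξ'} : Set M)) z := by
      have hmin := minpoly.algebraMap_eq (A := adjoin B ({ξ'} : Set M))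
        (algebraMap M Φ).injective (⟨z, hz⟩ : M)
      change (minpoly _ z).Separable
      have hz' : (algebraMap M Φ) ⟨z, hz⟩ = z := rfl
      rw [hz'] at hmin
      rw [hmin]
      exact h1
    exact isSeparable_of_ringHom_comp_eq f₁ (RingHom.ext fun _ => rfl) h2
  -- finiteness over `B(ξ)`: `M = B(ξ)(t, T)` with `t, T` algebraic over `B(ξ)`
  have halgξ : ∀ z ∈ M, IsAlgebraic kξ z := by
    intro z hz
    have h1 : IsAlgebraic (adjoin B ((↑({ξ'} : Finset M)) : Set M)) (⟨z, hz⟩ : M) :=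
      Algebra.IsAlgebraic.isAlgebraic _
    rw [hcoe] at h1
    exact h1.ringHom_of_comp_eq f₁ (algebraMap M Φ) (fun a b h => Subtype.ext
      (Subtype.ext (congrArg (fun w : kξ => (w : Φ)) h))) hf₁c
  have hfinξ : FiniteDimensional kξ (extendScalars hkξM) := by
    haveI : FiniteDimensional kξ (adjoin kξ (↑(insert t T) : Set Φ)) := by
      refine finiteDimensional_adjoin fun z hz => (halgξ z ?_).isIntegral
      rw [← hgen']
      exact subset_adjoin B _ hz
    have heq : adjoin kξ (↑(insert t T) : Set Φ) = extendScalars hkξM := by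
      apply restrictScalars_injective B
      rw [extendScalars_restrictScalars, hkξ, adjoin_adjoin_left, ← hgen']
      apply le_antisymm
      · rw [adjoin_le_iff]
        rintro z (hz | hz)
        · rw [Set.mem_singleton_iff] at hz
          subst hz
          rw [hgen']
          exact ξ'.2
        · exact subset_adjoin B _ hz
      · exact adjoin.mono B _ _ Set.subset_union_right
    rw [← heq]
    infer_instance
  have hposξ : 0 < Subfield.relfinrank kξ.toSubfield L := by
    rw [Subfield.relfinrank_eq_finrank_of_le hkξL]
    haveI := hfinξ
    exact Module.finrank_pos (R := kξ) (M := extendScalars hkξM)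
  exact ⟨ξ, hξL, hξtr, hkξL, hposξ, hsepΦ⟩

end Literature.AlgebraicGeometry.Resolution
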